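import Mathlib.Analysis.Complex.Isometry
import Mathlib.Data.Set.Card
import Literature.Geometry.DiscreteGeometry.HeitmannRadinDefects
import Literature.MathematicalPhysics.StatisticalMechanics.Theil2006EnergyBounds
import HarnessLib

/-!
# Theil 2006, §3: the local characterization of the triangular lattice
((42)–(43) ⇒ `Ω` countable and `RΩ + τ = A₂`) — proved

Topic `Literature/MathematicalPhysics/StatisticalMechanics`; companion of `Theil2006.lean` and
`Theil2006Periodic.lean` (F. Theil, *A proof of crystallization in two dimensions*, Comm. Math.
Phys. **262** (2006) 209–236; read in the author's accepted preprint of 26 Aug 2005, numbering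
identical, lit store `paper:url-69bff4ce1e30`).

## Source, verbatim (§3 Proof of Theorem 1.2, preprint p. 13)

"It can be shown with elementary methods that every nonempty set `Ω ⊂ ℝ²` with the properties
(42) `min_{y,y' ∈ Ω, y ≠ y'} |y - y'| ≥ 1` and
(43) `#{y' ∈ Ω | |y - y'| ≤ 1} = 7` for all `y ∈ Ω`
is countable and there exists a rotation `R ∈ SO(2)` and a translation `τ ∈ ℝ²` such that
`RΩ + τ = A₂`."

The paper gives no proof. The statement is the step on which the proofs of Theorem 1.2 (p. 14:
"Hence, the set `Ω = {y_min(x) | x ∈ A₂}` satisfies (42) and (43) and consequentially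
`RΩ + τ = A₂` …") and of Corollary 1.3 (p. 15) rest; in the tree it is quoted in the docstrings of
`Theil2006_periodicGroundStates_upToRotation` and `Theil2006.exists_rotation_range_rotated7`
(`Theil2006Periodic.lean`). This file PROVES it (no named fact, no `sorry`):

* `Theil2006.countable_and_exists_rotation_of_local` — for `Ω ⊂ ℝ²` (`Plane`) nonempty with
  (42) `∀ y ≠ y' ∈ Ω, 1 ≤ dist y y'` and (43) `#{y' ∈ Ω | dist y y' ≤ 1} = 7` (`Set.ncard`, the
  point `y` itself counted, as printed): `Ω` is countable and there are a linear isometry `R` of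
  `ℝ²` of determinant `1` (a rotation, `R ∈ SO(2)`) and `τ ∈ ℝ²` with `(R · + τ) '' Ω = A₂`
  (`= Theil2006.triangularLattice`);
* `Theil2006.exists_rotation_range_eq_triangularLattice` — the same for `Ω = {y(x) | x ∈ X}` the
  image of a map, with the conclusion in the shape `Set.range (fun x => R (y x) + τ) = A₂` used by
  `Theil2006_periodicGroundStates_upToRotation`;
* the complex-plane form `Theil2006.eq_lattice_of_local` / `countable_and_exists_rotation`:
  `Ω = y₀ + w (ℤ + ℤζ)`, `|w| = 1`, `ζ = e^{iπ/3}`, and `(w̄ · - w̄ y₀) '' Ω = ℤ + ℤζ` with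
  `w̄ ·` the Mathlib rotation `rotation ⟨w̄⟩` (`det = 1`: `det_rotation`);
* sharpness / non-vacuity: `A₂` itself satisfies (42) and (43)
  (`Theil2006.triangularLattice_sep`, `Theil2006.ncard_triangularLattice_closedBall`).

## The elementary proof formalised here

Work in `ℂ ≅ ℝ²` (`Complex.orthonormalBasisOneI`), `ζ = e^{iπ/3}`.
1. *Hexagons.* For `y ∈ Ω` the seven points of `Ω ∩ B̄(y, 1)` form a hard (1-separated) finite
   configuration in which `y` has six neighbours at distance exactly `1` ((42) and (43)); by the
   planar kissing rigidity already in the tree (`Harborth.nbrs_eq_hexagon_of_card_eq_six`,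
   `HeitmannRadinDefects.lean`: six gaps `≥ π/3` summing to `2π` are all tight) they are
   `y + w ζ^j`, `j = 0,…,5`, for a unit `w` — "`y` is `w`-framed" (`exists_framed`).
2. *Propagation.* If `y` is `w`-framed then so is each neighbour `y' = y + wζ^j`, with the SAME
   `w`: `y` is a neighbour of `y'`, so `-wζ^j = w'ζ^a` for the frame `w'` of `y'`, whence
   `w' ∈ w ζ^ℕ` and the two hexagons `y' + w'ζ^ℕ`, `y' + wζ^ℕ` coincide (`framed_step`). By
   induction over `ℤ²` every point `y₀ + w(a + bζ)` lies in `Ω` and is `w`-framed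
   (`framed_lattice`).
3. *Covering.* Every `z ∈ ℂ` is `y₀ + w(s + tζ)` with `s, t ∈ ℝ`; with `u = s - ⌊s⌋`,
   `v = t - ⌊t⌋ ∈ [0,1)` one of the four cell corners is at distance `< 1` from `z`
   (`|p + qζ|² = p² + pq + q²`; `u + v < 1 ⇒ u² + uv + v² < 1`, else
   `(1-u)² + (1-u)(1-v) + (1-v)² = (2-u-v)² - (1-u)(1-v) < 1`), so by (42) a point `z ∈ Ω` IS that
   corner: `Ω = y₀ + w(ℤ + ℤζ)` (`eq_lattice_of_local`), countable.
4. *Rigid motion.* `R = w̄ ·` (`|w̄| = 1`, `det R = 1`), `τ = -w̄ y₀`: `RΩ + τ = ℤ + ℤζ`, which the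
   identification `ℂ ≅ ℝ²` carries to `A₂ = {m b₁ + n b₂}`, `b₁ = (1,0)`, `b₂ = (1/2, √3/2)`
   (`toComplex_triPoint`); determinants are invariant under the conjugation (`LinearMap.det_conj`).

Hypothesis (42) is rendered pairwise (`∀ y ∈ Ω, ∀ y' ∈ Ω, y ≠ y' → 1 ≤ dist y y'`, the meaning of
the printed `min ≥ 1` for an infinite set); (43) with Mathlib's `Set.ncard` (a set of `ncard 7` is
finite). "Rotation `R ∈ SO(2)`" is rendered as a linear isometry equivalence of `ℝ²` with
`LinearMap.det R = 1`. Everything here is proved; no new facts (D-0026).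
[cite: Theil2006, §3 Proof of Theorem 1.2, (42)–(43) and «RΩ + τ = A₂» (preprint p. 13)]
-/

noncomputable section

open Complex
open scoped Real

namespace Literature.MathematicalPhysics.StatisticalMechanics

namespace Theil2006

open Literature.Geometry.DiscreteGeometry

/-- `ζ = e^{iπ/3}`, the generator of the hexagon of nearest neighbours (local notation). -/
local notation "ζ" => Complex.exp (((π / 3 : ℝ) : ℂ) * Complex.I)

set_option quotPrecheck false in
/-- The triangular lattice `ℤ + ℤζ ⊂ ℂ` (local notation; `= A₂` under `ℂ ≅ ℝ²`,
`toComplex_triPoint`). -/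
local notation "Λ₆" => (Set.range fun k : ℤ × ℤ => (k.1 : ℂ) + (k.2 : ℂ) * ζ)

set_option quotPrecheck false in
/-- "`y` is `w`-framed in `Ω`": `y ∈ Ω`, `|w| = 1`, and the points of `Ω` at distance exactly `1`
from `y` are precisely the hexagon `y + w ζ^j` (local notation `⬡[Ω, y, w]` for the recurring
predicate). -/
local notation:max "⬡[" Ω ", " y ", " w "]" =>
  (y ∈ Ω ∧ ‖w‖ = 1 ∧ ∀ z : ℂ, (z ∈ Ω ∧ ‖z - y‖ = 1) ↔ ∃ j : ℕ, z = y + w * ζ ^ j)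

/-! ## §1 Arithmetic of `ζ = e^{iπ/3}` and of the norm form `s² + st + t²` -/

/-- `ζ⁶ = 1` (private plumbing). [folklore] -/
private theorem zeta_pow_six : ζ ^ 6 = 1 := Harborth.exp_pi_div_three_mul_I_pow_six

/-- `ζ³ = -1` (private plumbing). [folklore] -/
private theorem zeta_pow_three : ζ ^ 3 = -1 := Harborth.exp_pi_div_three_mul_I_pow_three

/-- `ζ⁴ = -ζ` (private plumbing). [folklore] -/
private theorem zeta_pow_four : ζ ^ 4 = -ζ := by
  have h := zeta_pow_three
  linear_combination ζ * h

/-- `|ζ| = 1` (private plumbing). [folklore] -/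
private theorem norm_zeta : ‖ζ‖ = 1 := Harborth.norm_exp_pi_div_three_mul_I

/-- `|ζ^j| = 1` (private plumbing). [folklore] -/
private theorem norm_zeta_pow (j : ℕ) : ‖ζ ^ j‖ = 1 := by
  rw [norm_pow, norm_zeta, one_pow]

/-- `ζ^(j + 6m) = ζ^j` (private plumbing). [folklore] -/
private theorem zeta_pow_add_six_mul (j m : ℕ) : ζ ^ (j + 6 * m) = ζ ^ j := by
  rw [pow_add, pow_mul, zeta_pow_six, one_pow, mul_one]

/-- `ζ^(j mod 6) = ζ^j` (private plumbing). [folklore] -/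
private theorem zeta_pow_mod_six (j : ℕ) : ζ ^ (j % 6) = ζ ^ j := by
  conv_rhs => rw [← Nat.mod_add_div j 6]
  rw [zeta_pow_add_six_mul]

/-- The norm form of the triangular lattice: `|s + tζ|² = s² + st + t²` for real `s, t`
(private plumbing). [folklore] -/
private theorem norm_sq_coord (s t : ℝ) :
    ‖(s : ℂ) + (t : ℂ) * ζ‖ ^ 2 = s ^ 2 + s * t + t ^ 2 := by
  rw [Harborth.exp_pi_div_three_mul_I, Complex.sq_norm, Complex.normSq_apply]
  have h3 : Real.sqrt 3 * Real.sqrt 3 = 3 := Real.mul_self_sqrt (by norm_num)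
  simp only [add_re, add_im, mul_re, mul_im, ofReal_re, ofReal_im, zero_mul, sub_zero, add_zero,
    zero_add]
  linear_combination (t ^ 2 / 4) * h3

/-- `1, ζ` is a real basis of `ℂ`: every `z` is `s + tζ` with `s = Re z - Im z/√3`,
`t = 2 Im z/√3` (private plumbing). [folklore] -/
private theorem exists_coord (z : ℂ) : ∃ s t : ℝ, z = (s : ℂ) + (t : ℂ) * ζ := by
  refine ⟨z.re - z.im / Real.sqrt 3, 2 * z.im / Real.sqrt 3, ?_⟩
  rw [Harborth.exp_pi_div_three_mul_I]
  have h3 : Real.sqrt 3 ≠ 0 := by positivity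
  have h3' : Real.sqrt 3 / Real.sqrt 3 = 1 := div_self h3
  apply Complex.ext
  · simp only [add_re, mul_re, ofReal_re, ofReal_im, zero_mul, sub_zero]
    ring
  · simp only [add_im, mul_im, ofReal_re, ofReal_im, zero_mul, add_zero, zero_add]
    linear_combination (-z.im) * h3'

/-- A complex number of norm-square `< 1` has norm `< 1` (private plumbing). [folklore] -/
private theorem norm_lt_one_of_sq_lt {x : ℂ} (h : ‖x‖ ^ 2 < 1) : ‖x‖ < 1 := by
  nlinarith [norm_nonneg x]

/-- **Covering radius of the unit cell.** For `u, v ∈ [0,1)` one of the four corners `a + bζ`,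
`a, b ∈ {0, 1}`, of the lattice cell is at distance `< 1` from `u + vζ`: if `u + v < 1` the corner
`0` (`u² + uv + v² ≤ (u+v)² < 1`), otherwise the corner `1 + ζ`
(`(1-u)² + (1-u)(1-v) + (1-v)² = (2-u-v)² - (1-u)(1-v) < 1`) (private plumbing). [folklore] -/
private theorem exists_corner_near {u v : ℝ} (hu0 : 0 ≤ u) (hu1 : u < 1) (hv0 : 0 ≤ v)
    (hv1 : v < 1) : ∃ a b : ℤ, ‖((u - a : ℝ) : ℂ) + ((v - b : ℝ) : ℂ) * ζ‖ < 1 := by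
  by_cases huv : u + v < 1
  · refine ⟨0, 0, norm_lt_one_of_sq_lt ?_⟩
    rw [norm_sq_coord]
    push_cast
    have h1 : 0 < 1 - (u + v) := by linarith
    have h2 : 0 < 1 + (u + v) := by linarith
    nlinarith [mul_nonneg hu0 hv0, mul_pos h1 h2]
  · refine ⟨1, 1, norm_lt_one_of_sq_lt ?_⟩
    rw [norm_sq_coord]
    push_cast
    have h1 : 0 < 1 - u := by linarith
    have h2 : 0 < 1 - v := by linarith
    have h3 : (1 - u) + (1 - v) ≤ 1 := by linarith
    have h4 : 0 ≤ (1 - u) + (1 - v) := by linarith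
    nlinarith [mul_pos h1 h2, mul_le_mul h3 h3 h4 zero_le_one]

/-- Changing the frame by a power of `ζ` does not change the hexagon `y + w ζ^ℕ`
(private plumbing). [folklore] -/
private theorem hexagon_frame_eq {w w' : ℂ} {m : ℕ} (h : w' = w * ζ ^ m) (y z : ℂ) :
    (∃ j : ℕ, z = y + w' * ζ ^ j) ↔ ∃ j : ℕ, z = y + w * ζ ^ j := by
  constructor
  · rintro ⟨j, rfl⟩
    exact ⟨m + j, by rw [h, pow_add, mul_assoc]⟩
  · rintro ⟨j, rfl⟩
    refine ⟨5 * m + j, ?_⟩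
    rw [h, mul_assoc, ← pow_add, show m + (5 * m + j) = j + 6 * m by ring, zeta_pow_add_six_mul]

/-! ## §2 The complex-plane form: hexagons, propagation, covering -/

section ComplexPlane

variable {Ω : Set ℂ}

/-- **Step 1 (hexagons).** Under (42)–(43) every `y ∈ Ω` is framed: the points of `Ω` at
distance `1` from `y` are the six vertices `y + wζ^j` of a regular unit hexagon. The seven points
of `Ω ∩ B̄(y,1)` form a hard configuration in which `y` touches the other six, and six unit discs
touching one disc are rigid (`Harborth.nbrs_eq_hexagon_of_card_eq_six`).
[cite: Theil2006, §3 (42)–(43) (preprint p. 13), step 1 of our proof] -/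
theorem exists_framed (h42 : ∀ y ∈ Ω, ∀ y' ∈ Ω, y ≠ y' → 1 ≤ dist y y')
    (h43 : ∀ y ∈ Ω, {y' ∈ Ω | dist y y' ≤ 1}.ncard = 7) {y : ℂ} (hy : y ∈ Ω) :
    ∃ w : ℂ, ⬡[Ω, y, w] := by
  classical
  have hSfin : ({y' ∈ Ω | dist y y' ≤ 1} : Set ℂ).Finite :=
    Set.finite_of_ncard_ne_zero (by rw [h43 y hy]; norm_num)
  have hPcard : hSfin.toFinset.card = 7 := by
    rw [← Set.ncard_eq_toFinset_card _ hSfin]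
    exact h43 y hy
  -- the seven points of `Ω ∩ B̄(y, 1)` as a finite configuration `P`
  obtain ⟨P, hmemP, hP7⟩ : ∃ P : Finset ℂ, (∀ z, z ∈ P ↔ z ∈ Ω ∧ dist y z ≤ 1) ∧ P.card = 7 :=
    ⟨hSfin.toFinset, fun z => by rw [Set.Finite.mem_toFinset, Set.mem_setOf_eq], hPcard⟩
  have hyP : y ∈ P := (hmemP y).2 ⟨hy, by simp⟩
  have hhard : Harborth.IsHard P := by
    intro p hp q hq hpq
    rw [← dist_eq_norm, dist_comm]
    exact h42 p ((hmemP p).1 hp).1 q ((hmemP q).1 hq).1 hpq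
  -- by (42) and (43), `y` touches the six other points of `P`
  have hnbrs : Harborth.nbrs P y = P.erase y := by
    ext q
    rw [Harborth.mem_nbrs, Finset.mem_erase]
    constructor
    · rintro ⟨hq, h1⟩
      refine ⟨?_, hq⟩
      rintro rfl
      simp at h1
    · rintro ⟨hqy, hq⟩
      refine ⟨hq, le_antisymm ?_ ?_⟩
      · rw [← dist_eq_norm, dist_comm]
        exact ((hmemP q).1 hq).2
      · rw [← dist_eq_norm, dist_comm]
        exact h42 y hy q ((hmemP q).1 hq).1 (Ne.symm hqy)
  have h6 : (Harborth.nbrs P y).card = 6 := by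
    rw [hnbrs, Finset.card_erase_of_mem hyP, hP7]
  -- planar kissing rigidity: the six neighbours form a regular hexagon
  obtain ⟨w, hw, hhex⟩ := Harborth.nbrs_eq_hexagon_of_card_eq_six hhard h6
  refine ⟨w, hy, hw, fun z => ?_⟩
  constructor
  · rintro ⟨hz, hz1⟩
    have hzn : z ∈ Harborth.nbrs P y := by
      rw [Harborth.mem_nbrs]
      refine ⟨(hmemP z).2 ⟨hz, le_of_eq ?_⟩, hz1⟩
      rw [dist_comm, dist_eq_norm, hz1]
    rw [hhex] at hzn
    obtain ⟨j, -, hj⟩ := Finset.mem_image.1 hzn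
    exact ⟨j, hj.symm⟩
  · rintro ⟨j, rfl⟩
    have hzn : y + w * ζ ^ j ∈ Harborth.nbrs P y := by
      rw [hhex]
      exact Finset.mem_image.2
        ⟨j % 6, Finset.mem_range.2 (Nat.mod_lt _ (by norm_num)), by rw [zeta_pow_mod_six]⟩
    rw [Harborth.mem_nbrs] at hzn
    exact ⟨((hmemP _).1 hzn.1).1, hzn.2⟩

/-- **Step 2 (propagation along one bond).** If `y` is `w`-framed then each of its six neighbours
`y + wζ^j` is `w`-framed with the same `w`: `y` is a neighbour of `y' = y + wζ^j`, so the frame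
`w'` of `y'` satisfies `w'ζ^a = -wζ^j = wζ^{j+3}`, i.e. `w' = wζ^{j+3+5a}`, and the hexagons
`y' + w'ζ^ℕ = y' + wζ^ℕ` coincide. [cite: Theil2006, §3 (42)–(43) (preprint p. 13), step 2 of our proof] -/
theorem framed_step (h42 : ∀ y ∈ Ω, ∀ y' ∈ Ω, y ≠ y' → 1 ≤ dist y y')
    (h43 : ∀ y ∈ Ω, {y' ∈ Ω | dist y y' ≤ 1}.ncard = 7) {y w : ℂ} (hf : ⬡[Ω, y, w])
    (j : ℕ) : ⬡[Ω, y + w * ζ ^ j, w] := by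
  obtain ⟨hy, hw, hiff⟩ := hf
  have hy' : y + w * ζ ^ j ∈ Ω := ((hiff (y + w * ζ ^ j)).2 ⟨j, rfl⟩).1
  obtain ⟨w', -, -, hiff'⟩ := exists_framed h42 h43 hy'
  -- `y` is a neighbour of `y'`
  have hyy' : y ∈ Ω ∧ ‖y - (y + w * ζ ^ j)‖ = 1 := by
    refine ⟨hy, ?_⟩
    rw [show y - (y + w * ζ ^ j) = -(w * ζ ^ j) by ring, norm_neg, norm_mul, hw, norm_zeta_pow,
      one_mul]
  obtain ⟨a, ha⟩ := (hiff' y).1 hyy'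
  have h1 : w' * ζ ^ a = w * ζ ^ (j + 3) := by
    rw [pow_add, zeta_pow_three]
    linear_combination (-1 : ℂ) * ha
  have hw'eq : w' = w * ζ ^ (j + 3 + 5 * a) :=
    calc w' = w' * ζ ^ a * ζ ^ (5 * a) := by
          rw [mul_assoc, ← pow_add, show a + 5 * a = 0 + 6 * a by ring, zeta_pow_add_six_mul,
            pow_zero, mul_one]
      _ = w * ζ ^ (j + 3) * ζ ^ (5 * a) := by rw [h1]
      _ = w * ζ ^ (j + 3 + 5 * a) := by rw [mul_assoc, ← pow_add]
  refine ⟨hy', hw, fun z => ?_⟩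
  rw [hiff' z]
  exact hexagon_frame_eq hw'eq _ _

/-- **Step 2 (propagation over the lattice).** If `y` is `w`-framed then every point
`y + w(a + bζ)`, `a, b ∈ ℤ`, lies in `Ω` and is `w`-framed (induction over `ℤ²` along the unit
steps `±w = wζ^{0,3}`, `±wζ = wζ^{1,4}`). [cite: Theil2006, §3 (42)–(43) (preprint p. 13), step 2 of our proof] -/
theorem framed_lattice (h42 : ∀ y ∈ Ω, ∀ y' ∈ Ω, y ≠ y' → 1 ≤ dist y y')
    (h43 : ∀ y ∈ Ω, {y' ∈ Ω | dist y y' ≤ 1}.ncard = 7) {y w : ℂ} (hf : ⬡[Ω, y, w])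
    (a b : ℤ) : ⬡[Ω, y + w * ((a : ℂ) + (b : ℂ) * ζ), w] := by
  have s1 : ∀ p : ℂ, ⬡[Ω, p, w] → ⬡[Ω, p + w, w] := fun p hp => by
    simpa using framed_step h42 h43 hp 0
  have s2 : ∀ p : ℂ, ⬡[Ω, p, w] → ⬡[Ω, p - w, w] := fun p hp => by
    have h := framed_step h42 h43 hp 3
    rwa [zeta_pow_three, mul_neg_one, ← sub_eq_add_neg] at h
  have s3 : ∀ p : ℂ, ⬡[Ω, p, w] → ⬡[Ω, p + w * ζ, w] := fun p hp => by
    simpa using framed_step h42 h43 hp 1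
  have s4 : ∀ p : ℂ, ⬡[Ω, p, w] → ⬡[Ω, p - w * ζ, w] := fun p hp => by
    have h := framed_step h42 h43 hp 4
    rwa [zeta_pow_four, mul_neg, ← sub_eq_add_neg] at h
  have hrow : ∀ a : ℤ, ⬡[Ω, y + w * (a : ℂ), w] := by
    intro a
    induction a using Int.induction_on with
    | zero => simpa using hf
    | succ n ih =>
      have e : y + w * (((n : ℤ) + 1 : ℤ) : ℂ) = y + w * ((n : ℤ) : ℂ) + w := by
        push_cast
        ring
      rw [e]
      exact s1 _ ih
    | pred n ih =>
      have e : y + w * ((-(n : ℤ) - 1 : ℤ) : ℂ) = y + w * ((-(n : ℤ) : ℤ) : ℂ) - w := by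
        push_cast
        ring
      rw [e]
      exact s2 _ ih
  induction b using Int.induction_on with
  | zero => simpa using hrow a
  | succ n ih =>
    have e : y + w * ((a : ℂ) + (((n : ℤ) + 1 : ℤ) : ℂ) * ζ) =
        y + w * ((a : ℂ) + ((n : ℤ) : ℂ) * ζ) + w * ζ := by
      push_cast
      ring
    rw [e]
    exact s3 _ ih
  | pred n ih =>
    have e : y + w * ((a : ℂ) + ((-(n : ℤ) - 1 : ℤ) : ℂ) * ζ) =
        y + w * ((a : ℂ) + ((-(n : ℤ) : ℤ) : ℂ) * ζ) - w * ζ := by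
      push_cast
      ring
    rw [e]
    exact s4 _ ih

/-- **Steps 1–3: `Ω` is a congruent copy of the triangular lattice.** A nonempty `Ω ⊂ ℂ` with
(42) (distinct points at distance `≥ 1`) and (43) (every point has exactly seven points of `Ω` in
its closed unit disc) is EQUAL to `y₀ + w(ℤ + ℤζ)` for some `y₀ ∈ Ω` and unit `w`: it contains this
lattice by propagation, and a point of `Ω` off it would be at distance `< 1` from a lattice point
(covering radius of the cell), contradicting (42).
[cite: Theil2006, §3 (42)–(43) «RΩ + τ = A₂» (preprint p. 13), complex form] -/
theorem eq_lattice_of_local (hne : Ω.Nonempty) (h42 : ∀ y ∈ Ω, ∀ y' ∈ Ω, y ≠ y' → 1 ≤ dist y y')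
    (h43 : ∀ y ∈ Ω, {y' ∈ Ω | dist y y' ≤ 1}.ncard = 7) :
    ∃ y₀ w : ℂ, ‖w‖ = 1 ∧ Ω = Set.range fun k : ℤ × ℤ => y₀ + w * ((k.1 : ℂ) + (k.2 : ℂ) * ζ) := by
  obtain ⟨y₀, hy₀⟩ := hne
  obtain ⟨w, hf⟩ := exists_framed h42 h43 hy₀
  have hw : ‖w‖ = 1 := hf.2.1
  refine ⟨y₀, w, hw, Set.Subset.antisymm ?_ ?_⟩
  · intro z hz
    have hw0 : w ≠ 0 := by
      rintro rfl
      simp at hw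
    obtain ⟨s, t, hst⟩ := exists_coord ((z - y₀) / w)
    have hz_eq : z = y₀ + w * ((s : ℂ) + (t : ℂ) * ζ) := by
      rw [← hst, mul_div_cancel₀ _ hw0]
      ring
    obtain ⟨a', b', hlt⟩ := exists_corner_near (Int.fract_nonneg s) (Int.fract_lt_one s)
      (Int.fract_nonneg t) (Int.fract_lt_one t)
    have hq := (framed_lattice h42 h43 hf (⌊s⌋ + a') (⌊t⌋ + b')).1
    have hd : dist z (y₀ + w * (((⌊s⌋ + a' : ℤ) : ℂ) + ((⌊t⌋ + b' : ℤ) : ℂ) * ζ)) < 1 := by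
      rw [dist_eq_norm, hz_eq]
      have e : y₀ + w * ((s : ℂ) + (t : ℂ) * ζ) -
          (y₀ + w * (((⌊s⌋ + a' : ℤ) : ℂ) + ((⌊t⌋ + b' : ℤ) : ℂ) * ζ)) =
          w * (((Int.fract s - a' : ℝ) : ℂ) + ((Int.fract t - b' : ℝ) : ℂ) * ζ) := by
        simp only [Int.fract]
        push_cast
        ring
      rw [e, norm_mul, hw, one_mul]
      exact hlt
    by_cases hzq : z = y₀ + w * (((⌊s⌋ + a' : ℤ) : ℂ) + ((⌊t⌋ + b' : ℤ) : ℂ) * ζ)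
    · exact ⟨(⌊s⌋ + a', ⌊t⌋ + b'), hzq.symm⟩
    · have h1 := h42 z hz _ hq hzq
      linarith
  · rintro z ⟨⟨a, b⟩, rfl⟩
    exact (framed_lattice h42 h43 hf a b).1

/-- **The statement of §3, p. 13, in the complex plane.** A nonempty `Ω ⊂ ℂ` with (42) and (43)
is countable, and `RΩ + τ = ℤ + ℤζ` for the rotation `R = w̄ ·` (Mathlib's `rotation ⟨w̄⟩`,
`|w̄| = 1`, of determinant `1` by `det_rotation`) and the translation `τ = -w̄ y₀`.
[cite: Theil2006, §3 (42)–(43) «RΩ + τ = A₂» (preprint p. 13), complex form] -/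
theorem countable_and_exists_rotation (hne : Ω.Nonempty)
    (h42 : ∀ y ∈ Ω, ∀ y' ∈ Ω, y ≠ y' → 1 ≤ dist y y')
    (h43 : ∀ y ∈ Ω, {y' ∈ Ω | dist y y' ≤ 1}.ncard = 7) :
    Ω.Countable ∧ ∃ (a : Circle) (τ : ℂ), (fun z => rotation a z + τ) '' Ω = Λ₆ := by
  obtain ⟨y₀, w, hw, hΩ⟩ := eq_lattice_of_local hne h42 h43
  refine ⟨by rw [hΩ]; exact Set.countable_range _, ?_⟩
  have hwbar : ‖(starRingEnd ℂ) w‖ = 1 := by rw [Complex.norm_conj, hw]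
  have hcw : (starRingEnd ℂ) w * w = 1 := by
    rw [← Complex.normSq_eq_conj_mul_self, Complex.normSq_eq_norm_sq, hw]
    norm_num
  obtain ⟨a, ha⟩ : ∃ a : Circle, (a : ℂ) = (starRingEnd ℂ) w :=
    ⟨⟨(starRingEnd ℂ) w, mem_sphere_zero_iff_norm.2 hwbar⟩, rfl⟩
  refine ⟨a, -((starRingEnd ℂ) w * y₀), ?_⟩
  rw [hΩ]
  ext v
  simp only [Set.mem_image, Set.mem_range, rotation_apply, ha]
  constructor
  · rintro ⟨z, ⟨k, rfl⟩, rfl⟩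
    exact ⟨k, by linear_combination (-((k.1 : ℂ) + (k.2 : ℂ) * ζ)) * hcw⟩
  · rintro ⟨k, rfl⟩
    exact ⟨y₀ + w * ((k.1 : ℂ) + (k.2 : ℂ) * ζ), ⟨k, rfl⟩,
      by linear_combination ((k.1 : ℂ) + (k.2 : ℂ) * ζ) * hcw⟩

end ComplexPlane

/-! ## §3 Transfer to `ℝ²` and the statement as printed -/

/-- The identification `ℝ² ≅ ℂ` (`(x₀, x₁) ↦ x₀ + x₁ i`) carries `A₂ = {m b₁ + n b₂}` onto
`ℤ + ℤζ`: `m b₁ + n b₂ ↦ m + nζ` (`b₁ = (1,0) ↦ 1`, `b₂ = (1/2, √3/2) ↦ ζ`).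
[cite: Theil2006, §1 (A₂ = ½ (2 1; 0 √3) ℤ²) with HeitmannRadin1980 §2 («m + n exp(iπ/3)»)] -/
theorem toComplex_triPoint (k : ℤ × ℤ) :
    Complex.orthonormalBasisOneI.repr.symm (triPoint k) = (k.1 : ℂ) + (k.2 : ℂ) * ζ := by
  rw [Harborth.exp_pi_div_three_mul_I]
  apply Complex.ext
  · simp [Complex.orthonormalBasisOneI_repr_symm_apply]
    ring
  · simp [Complex.orthonormalBasisOneI_repr_symm_apply]
    ring

/-- **Theil 2006, §3 (p. 13): the local characterization of the triangular lattice — proved.**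
"every nonempty set `Ω ⊂ ℝ²` with the properties (42) `min_{y,y' ∈ Ω, y ≠ y'} |y - y'| ≥ 1` and
(43) `#{y' ∈ Ω | |y - y'| ≤ 1} = 7` for all `y ∈ Ω` is countable and there exists a rotation
`R ∈ SO(2)` and a translation `τ ∈ ℝ²` such that `RΩ + τ = A₂`." Here `R` is a linear isometry of
`ℝ²` with `det R = 1`, `A₂ = Theil2006.triangularLattice`, and (43) counts `y` itself
(`Set.ncard`). The paper states this without proof ("elementary methods"); ours is in the module
docstring. [cite: Theil2006, §3 Proof of Theorem 1.2, (42)–(43) «RΩ + τ = A₂» (preprint p. 13)] -/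
theorem countable_and_exists_rotation_of_local {Ω : Set Plane} (hne : Ω.Nonempty)
    (h42 : ∀ y ∈ Ω, ∀ y' ∈ Ω, y ≠ y' → 1 ≤ dist y y')
    (h43 : ∀ y ∈ Ω, {y' ∈ Ω | dist y y' ≤ 1}.ncard = 7) :
    Ω.Countable ∧ ∃ R : Plane ≃ₗᵢ[ℝ] Plane,
      LinearMap.det (R.toLinearEquiv : Plane →ₗ[ℝ] Plane) = 1 ∧
        ∃ τ : Plane, (fun y => R y + τ) '' Ω = triangularLattice := by
  set e : Plane ≃ₗᵢ[ℝ] ℂ := Complex.orthonormalBasisOneI.repr.symm with he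
  have hne' : (e '' Ω).Nonempty := hne.image e
  have h42' : ∀ y ∈ e '' Ω, ∀ y' ∈ e '' Ω, y ≠ y' → 1 ≤ dist y y' := by
    rintro _ ⟨y, hy, rfl⟩ _ ⟨y', hy', rfl⟩ hyy'
    rw [e.dist_map]
    exact h42 y hy y' hy' fun h => hyy' (by rw [h])
  have h43' : ∀ y ∈ e '' Ω, {y' ∈ e '' Ω | dist y y' ≤ 1}.ncard = 7 := by
    rintro _ ⟨y, hy, rfl⟩
    have hset : {y' ∈ e '' Ω | dist (e y) y' ≤ 1} = e '' {y' ∈ Ω | dist y y' ≤ 1} := by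
      ext z
      constructor
      · rintro ⟨⟨y', hy', rfl⟩, hd⟩
        exact ⟨y', ⟨hy', by rwa [e.dist_map] at hd⟩, rfl⟩
      · rintro ⟨y', ⟨hy', hd⟩, rfl⟩
        exact ⟨⟨y', hy', rfl⟩, by rwa [e.dist_map]⟩
    rw [hset, Set.ncard_image_of_injective _ e.injective, h43 y hy]
  obtain ⟨hcount, a, τ, himg⟩ := countable_and_exists_rotation hne' h42' h43'
  refine ⟨?_, e.trans ((rotation a).trans e.symm), ?_, e.symm τ, ?_⟩
  · -- countability is invariant under the bijection `e`
    have hΩe : Ω = e.symm '' (e '' Ω) := by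
      rw [Set.image_image]
      simp
    rw [hΩe]
    exact hcount.image _
  · -- `det (e⁻¹ ∘ R ∘ e) = det R = 1`
    have hconj : ((e.trans ((rotation a).trans e.symm)).toLinearEquiv : Plane →ₗ[ℝ] Plane) =
        (e.symm.toLinearEquiv : ℂ →ₗ[ℝ] Plane) ∘ₗ ((rotation a).toLinearEquiv : ℂ →ₗ[ℝ] ℂ) ∘ₗ
          (e.symm.toLinearEquiv.symm : Plane →ₗ[ℝ] ℂ) := by
      apply LinearMap.ext
      intro v
      rfl
    rw [hconj, LinearMap.det_conj, det_rotation]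
  · calc (fun y => (e.trans ((rotation a).trans e.symm)) y + e.symm τ) '' Ω
        = e.symm '' ((fun z => rotation a z + τ) '' (e '' Ω)) := by
          simp only [Set.image_image]
          refine Set.image_congr fun y _ => ?_
          rw [map_add]
          rfl
      _ = e.symm '' Λ₆ := by rw [himg]
      _ = triangularLattice := by
          rw [← Set.range_comp, triangularLattice]
          congr 1
          funext k
          simp only [Function.comp_apply]
          rw [← toComplex_triPoint k, ← he, e.symm_apply_apply]

/-- **The same for the image of a map** (the shape used by Theorem 1.2 / Corollary 1.3, where
`Ω = {y_min(x) | x ∈ A₂}`): if the values of `y : X → ℝ²` (`X` nonempty) are `1`-separated as a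
set and every value has exactly seven values in its closed unit disc, then for a rotation `R`
(`det R = 1`) and a translation `τ`, `{R y(x) + τ | x ∈ X} = A₂` — the conclusion of
`Theil2006_periodicGroundStates_upToRotation`.
[cite: Theil2006, §3 Proof of Theorem 1.2, (42)–(43) «RΩ + τ = A₂» (preprint pp. 13–14)] -/
theorem exists_rotation_range_eq_triangularLattice {X : Type*} [Nonempty X] {y : X → Plane}
    (h42 : ∀ x x' : X, y x ≠ y x' → 1 ≤ dist (y x) (y x'))
    (h43 : ∀ x : X, {p ∈ Set.range y | dist (y x) p ≤ 1}.ncard = 7) :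
    (Set.range y).Countable ∧ ∃ R : Plane ≃ₗᵢ[ℝ] Plane,
      LinearMap.det (R.toLinearEquiv : Plane →ₗ[ℝ] Plane) = 1 ∧
        ∃ τ : Plane, Set.range (fun x => R (y x) + τ) = triangularLattice := by
  obtain ⟨hc, R, hR, τ, hτ⟩ := countable_and_exists_rotation_of_local (Set.range_nonempty y)
    (by rintro _ ⟨x, rfl⟩ _ ⟨x', rfl⟩ hxx'; exact h42 x x' hxx') (by rintro _ ⟨x, rfl⟩; exact h43 x)
  refine ⟨hc, R, hR, τ, ?_⟩
  rw [← hτ, ← Set.range_comp]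
  rfl

/-! ## §4 Sharpness: `A₂` itself satisfies (42) and (43) -/

/-- (42) for `A₂`: distinct lattice points are at distance `≥ 1` (`|m b₁ + n b₂|² = m² + mn + n²
is a positive integer). [cite: Theil2006, §3 (42) (preprint p. 13), instance Ω = A₂] -/
theorem triangularLattice_sep :
    ∀ y ∈ triangularLattice, ∀ y' ∈ triangularLattice, y ≠ y' → 1 ≤ dist y y' := by
  rintro _ ⟨k, rfl⟩ _ ⟨k', rfl⟩ hkk'
  rw [dist_triPoint]
  exact one_le_norm_triPoint (sub_ne_zero.2 fun h => hkk' (by rw [h]))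

/-- (43) for `A₂`: every lattice point has exactly seven lattice points in its closed unit disc —
itself and its six nearest neighbours `η + ξ`, `ξ ∈ {±b₁, ±b₂, ±(b₁ - b₂)}` (the other lattice
vectors have length `≥ √3`). [cite: Theil2006, §3 (43) (preprint p. 13) with Remark 2.5 («#{η' ∈ A₂ | |η−η'| ∈ (0,1]} = 6», p. 7), instance Ω = A₂] -/
theorem ncard_triangularLattice_closedBall (η : Plane) (hη : η ∈ triangularLattice) :
    {η' ∈ triangularLattice | dist η η' ≤ 1}.ncard = 7 := by
  classical
  obtain ⟨k₀, rfl⟩ := hη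
  -- the seven labels: `k₀` and `k₀ + ξ`, `ξ ∈ unitShell`
  have hset : {η' ∈ triangularLattice | dist (triPoint k₀) η' ≤ 1} =
      (fun k => triPoint (k₀ + k)) '' ↑(insert (0 : ℤ × ℤ) unitShell) := by
    ext p
    constructor
    · rintro ⟨⟨k, rfl⟩, hd⟩
      refine ⟨k - k₀, ?_, by simp⟩
      rw [Finset.coe_insert, Set.mem_insert_iff, Finset.mem_coe]
      by_contra hnot
      push Not at hnot
      have h3 := sqrt_three_le_norm_triPoint hnot.1 hnot.2
      rw [dist_comm, dist_triPoint] at hd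
      have : Real.sqrt 3 ≤ 1 := h3.trans hd
      have h13 : (1 : ℝ) < Real.sqrt 3 := by
        rw [show (1 : ℝ) = Real.sqrt 1 by simp]
        exact Real.sqrt_lt_sqrt (by norm_num) (by norm_num)
      linarith
    · rintro ⟨k, hk, rfl⟩
      refine ⟨⟨k₀ + k, rfl⟩, ?_⟩
      rw [Finset.coe_insert, Set.mem_insert_iff, Finset.mem_coe] at hk
      rw [dist_comm, dist_triPoint, show k₀ + k - k₀ = k by abel]
      rcases hk with rfl | hk
      · simp
      · exact (norm_triPoint_of_mem_unitShell hk).le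
  have hinj : Function.Injective fun k : ℤ × ℤ => triPoint (k₀ + k) := fun k k' h =>
    add_left_cancel (triPoint_injective h)
  rw [hset, Set.ncard_image_of_injective _ hinj, Set.ncard_coe_finset,
    Finset.card_insert_of_notMem (by decide), card_unitShell]

end Theil2006

end Literature.MathematicalPhysics.StatisticalMechanics

end
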